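import Mathlib
import Summits.Ventures.PercRepro2.PMK5Deg3Kernel
import Summits.Ventures.PercRepro2.Deg3Kron
import Summits.Ventures.PercRepro2.Deg3Tables
import Summits.Ventures.PercRepro2.Deg3Slices
import Summits.Ventures.PercRepro2.PMK5Deg4Kernel
import Summits.Ventures.PercRepro2.Deg4Conn
import Summits.Ventures.PercRepro2.Deg4Tables
import Summits.Ventures.PercRepro2.PMK5Deg4Kernel5
import Summits.Ventures.PercRepro2.Deg4Kron5
import Summits.Ventures.PercRepro2.Deg4Digits5
import Summits.Ventures.PercRepro2.Deg4Bits5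
import Summits.Ventures.PercRepro2.Deg4Slices5

/-!
# THEOREM 29 — ROW 2′TRI AND (HCOV) ON EVERY `K₅ + {a₃x, a₃y, a₃z, a₃w}` WITH SLICE CERTIFICATES: THE DEGREE-4 FAMILY
(blind cell PercRepro2, mine-2 g28; mine-2 g27's `Deg3Typed.lean` (typer-1's `K5TypedK3.lean`) on the
fourteen-edge skeletons, parametrised by the attachment quadruple `(x, y, z, w)`, with the certificate SLICED along
the five edges `9, …, 13` (`PMK5Deg4Kernel5.lean`, `Deg4Slices5.lean`); Kronecker base `2^26`)

By `Deg4Tables.K3_apply`, on `K₅ + {a₃x, a₃y, a₃z, a₃w}` with the marks `(o, a₁, a₂, a₃, b) = (0, 1, 2, 5, 4)` the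
kernel `K₃ a b c` is a signed sum of twenty products of tables, so a typed count `typedCount F w₀ τ K₃` is the
signed triple count of the profile `k` of the minor `(F, w₀, τ)` (`typedCount_K3_eq`: `cntPos14 k − cntNeg14 k`).
The five-digit slice decomposition `Deg4Slices5.cntPos14_eq` / `cntNeg14_eq` (the edges `9, …, 13` sliced,
nine-edge numbers in the base `2^26`, `PMK5Deg4Kernel5.lean`) writes these as slice counts at the five last
digits of `k`, and a slice certificate `Five.CertS L j₁ … j₅` (one `decide +kernel` per slice, `1024` per quadruple)
bounds `cntNegS ≤ cntPosS` there (`Deg4Slices5.cntNegS_le_cntPosS`), hence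

* **`cntNeg14_le_cntPos14`**: `Five.LitOK L → Five.Cert L → ∀ k, cntNeg14 k ≤ cntPos14 k`;
* **`typedCount_K3_nonneg`**: every weight-free typed count of `K₃` on the fourteen-edge graph is `≥ 0` —
  all minors `(F, w₀)`, all type maps;
* **`typedBases`**: `CovForm.TypedBases (ends14 x y z w) 0 1 2 5 4` — row 2′TRI on `K₅ + {a₃x, a₃y, a₃z, a₃w}`;
* **`HCov_deg4`**: `CovForm.HCov p (ends14 x y z w) 0 1 2 5 4` for every probability vector
  `p : Fin 14 → R` — (HCOV) on every instance of the family (the ten base edges and the four `a₃`-edges at any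
  weights, missing edges at weight `0`), by `CovForm.HCov_of_typedBases`.
-/

namespace Summit.Ventures.PercRepro2

open Hub

namespace Deg4

/-! ## The tables of the family, by index -/

/-- The table `0` of `tab`. -/
lemma tab0 (x y z w : Fin 5) : tab x y z w 0 = tQ x y z w := rfl
/-- The table `1` of `tab`. -/
lemma tab1 (x y z w : Fin 5) : tab x y z w 1 = tPD x y z w := rfl
/-- The table `2` of `tab`. -/
lemma tab2 (x y z w : Fin 5) : tab x y z w 2 = tPDoU x y z w := rfl
/-- The table `3` of `tab`. -/
lemma tab3 (x y z w : Fin 5) : tab x y z w 3 = t4p x y z w := rfl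
/-- The table `4` of `tab`. -/
lemma tab4 (x y z w : Fin 5) : tab x y z w 4 = t4m x y z w := rfl
/-- The table `5` of `tab`. -/
lemma tab5 (x y z w : Fin 5) : tab x y z w 5 = t5p x y z w := rfl
/-- The table `6` of `tab`. -/
lemma tab6 (x y z w : Fin 5) : tab x y z w 6 = t5m x y z w := rfl
/-- The table `7` of `tab`. -/
lemma tab7 (x y z w : Fin 5) : tab x y z w 7 = t6p x y z w := rfl
/-- The table `8` of `tab`. -/
lemma tab8 (x y z w : Fin 5) : tab x y z w 8 = t6m x y z w := rfl
/-- The table `9` of `tab`. -/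
lemma tab9 (x y z w : Fin 5) : tab x y z w 9 = t7p x y z w 4 := rfl
/-- The table `10` of `tab`. -/
lemma tab10 (x y z w : Fin 5) : tab x y z w 10 = t7m x y z w 4 := rfl
/-- The table `11` of `tab`. -/
lemma tab11 (x y z w : Fin 5) : tab x y z w 11 = t7p x y z w 0 := rfl
/-- The table `12` of `tab`. -/
lemma tab12 (x y z w : Fin 5) : tab x y z w 12 = t7m x y z w 0 := rfl
/-- The table `13` of `tab`. -/
lemma tab13 (x y z w : Fin 5) : tab x y z w 13 = t7p x y z w 5 := rfl
/-- The table `14` of `tab`. -/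
lemma tab14 (x y z w : Fin 5) : tab x y z w 14 = t7m x y z w 5 := rfl
/-- The table `15` of `tab`. -/
lemma tab15 (x y z w : Fin 5) : tab x y z w 15 = t10p x y z w := rfl
/-- The table `16` of `tab`. -/
lemma tab16 (x y z w : Fin 5) : tab x y z w 16 = t10m x y z w := rfl
/-- The table `17` of `tab`. -/
lemma tab17 (x y z w : Fin 5) : tab x y z w 17 = t11 x y z w := rfl
/-- The table `18` of `tab`. -/
lemma tab18 (x y z w : Fin 5) : tab x y z w 18 = t12 x y z w := rfl

/-! ## Typed counts are signed triple counts -/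

section Counts

variable {R : Type*} [Field R] (x y z w : Fin 5)

/-- The profile of a minor `(F, w₀)` with types `τ ≤ 3` on `F`: `τ` on `F`, `3 · w₀` off `F`. -/
lemma exists_profile (F : Finset (Fin 14)) (w₀ : Config (Fin 14)) (τ : Fin 14 → ℕ)
    (hτ : ∀ e ∈ F, τ e ≤ 3) :
    ∃ k : Fin 14 → Fin 4, ∀ e, (k e : ℕ) = if e ∈ F then τ e else if w₀ e then 3 else 0 := by
  refine ⟨fun e => if he : e ∈ F then ⟨τ e, Nat.lt_succ_of_le (hτ e he)⟩ else if w₀ e then 3 else 0,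
    fun e => ?_⟩
  by_cases he : e ∈ F
  · simp [he]
  · simp only [dif_neg he, if_neg he]
    cases w₀ e <;> rfl

/-- The constraint of a typed count is the profile constraint `prof x y w = k`. -/
lemma typed_constraint_iff (F : Finset (Fin 14)) (w₀ : Config (Fin 14)) (τ : Fin 14 → ℕ)
    (k : Fin 14 → Fin 4) (hk : ∀ e, (k e : ℕ) = if e ∈ F then τ e else if w₀ e then 3 else 0)
    (x y w : Config (Fin 14)) :
    ((∀ e, e ∉ F → x e = w₀ e ∧ y e = w₀ e ∧ w e = w₀ e) ∧ (∀ e ∈ F, openCount x y w e = τ e)) ↔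
      prof x y w = k := by
  constructor
  · rintro ⟨h1, h2⟩
    funext e
    apply Fin.ext
    rw [hk e]
    by_cases he : e ∈ F
    · rw [if_pos he]
      exact h2 e he
    · rw [if_neg he]
      obtain ⟨hx, hy, hw⟩ := h1 e he
      simp only [Hub.prof, hx, hy, hw]
      cases w₀ e <;> rfl
  · intro hprof
    constructor
    · intro e he
      have := congrArg (fun f => (f e : ℕ)) hprof
      simp only [Hub.prof] at this
      rw [hk e, if_neg he] at this
      revert this
      cases w₀ e <;> cases x e <;> cases y e <;> cases w e <;> intro this <;> simp at this ⊢
    · intro e he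
      have := congrArg (fun f => (f e : ℕ)) hprof
      simp only [Hub.prof] at this
      rw [hk e, if_pos he] at this
      exact this

/-- The typed count of a product of three tables is the triple count of the profile. -/
lemma typedCount_tables (F : Finset (Fin 14)) (w₀ : Config (Fin 14)) (τ : Fin 14 → ℕ)
    (k : Fin 14 → Fin 4) (hk : ∀ e, (k e : ℕ) = if e ∈ F then τ e else if w₀ e then 3 else 0)
    (T₁ T₂ T₃ : (Fin 14 → Bool) → Bool) :
    typedCount F w₀ τ (fun x y w => indR (R := R) T₁ x * indR T₂ y * indR T₃ w) =
      ((Deg3.cnt3n T₁ T₂ T₃ k : ℕ) : R) := by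
  rw [← coef3_eq_cnt3n]
  unfold typedCount coef3
  simp only [typed_constraint_iff F w₀ τ k hk, Finset.sum_filter, Fintype.sum_prod_type]

/-- A typed count is linear in the kernel (sums). -/
lemma typedCount_add (F : Finset (Fin 14)) (w₀ : Config (Fin 14)) (τ : Fin 14 → ℕ)
    (K K' : Config (Fin 14) → Config (Fin 14) → Config (Fin 14) → R) :
    typedCount F w₀ τ (fun x y w => K x y w + K' x y w) = typedCount F w₀ τ K + typedCount F w₀ τ K' := by
  unfold typedCount
  simp only [← Finset.sum_add_distrib]
  refine Finset.sum_congr rfl fun x _ => Finset.sum_congr rfl fun y _ =>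
    Finset.sum_congr rfl fun w _ => ?_
  split_ifs <;> simp

/-- A typed count is linear in the kernel (differences). -/
lemma typedCount_sub (F : Finset (Fin 14)) (w₀ : Config (Fin 14)) (τ : Fin 14 → ℕ)
    (K K' : Config (Fin 14) → Config (Fin 14) → Config (Fin 14) → R) :
    typedCount F w₀ τ (fun x y w => K x y w - K' x y w) = typedCount F w₀ τ K - typedCount F w₀ τ K' := by
  unfold typedCount
  simp only [← Finset.sum_sub_distrib]
  refine Finset.sum_congr rfl fun x _ => Finset.sum_congr rfl fun y _ =>
    Finset.sum_congr rfl fun w _ => ?_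
  split_ifs <;> simp

/-- **A typed count of `K₃` on `K₅ + {a₃x, a₃y, a₃z, a₃w}` is the signed triple count of its profile.** -/
lemma typedCount_K3_eq (F : Finset (Fin 14)) (w₀ : Config (Fin 14)) (τ : Fin 14 → ℕ)
    (k : Fin 14 → Fin 4) (hk : ∀ e, (k e : ℕ) = if e ∈ F then τ e else if w₀ e then 3 else 0) :
    typedCount F w₀ τ (CovForm.K3 (R := R) (ends14 x y z w) 0 1 2 5 4) =
      ((Five.cntPos14 x y z w k : ℕ) : R) - ((Five.cntNeg14 x y z w k : ℕ) : R) := by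
  have hK : CovForm.K3 (R := R) (ends14 x y z w) 0 1 2 5 4 = fun a b c =>
      (indR (tPD x y z w) a * indR (tQ x y z w) b * indR (t4p x y z w) c + indR (tQ x y z w) a * indR (tPDoU x y z w) b * indR (t5p x y z w) c +
        indR (tPD x y z w) a * indR (tQ x y z w) b * indR (t6m x y z w) c +
        indR (tPD x y z w) a * indR (t7p x y z w 4) b * indR (t7m x y z w 0) c + indR (tPD x y z w) a * indR (t7m x y z w 4) b * indR (t7p x y z w 0) c +
        indR (tPDoU x y z w) a * indR (t7p x y z w 4) b * indR (t7m x y z w 5) c + indR (tPDoU x y z w) a * indR (t7m x y z w 4) b * indR (t7p x y z w 5) c +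
        indR (tPD x y z w) a * indR (t7p x y z w 4) b * indR (t10p x y z w) c + indR (tPD x y z w) a * indR (t7m x y z w 4) b * indR (t10m x y z w) c +
        indR (tQ x y z w) a * indR (t12 x y z w) b * indR (tPDoU x y z w) c) -
      (indR (tPD x y z w) a * indR (tQ x y z w) b * indR (t4m x y z w) c + indR (tQ x y z w) a * indR (tPDoU x y z w) b * indR (t5m x y z w) c +
        indR (tPD x y z w) a * indR (tQ x y z w) b * indR (t6p x y z w) c +
        indR (tPD x y z w) a * indR (t7p x y z w 4) b * indR (t7p x y z w 0) c + indR (tPD x y z w) a * indR (t7m x y z w 4) b * indR (t7m x y z w 0) c +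
        indR (tPDoU x y z w) a * indR (t7p x y z w 4) b * indR (t7p x y z w 5) c + indR (tPDoU x y z w) a * indR (t7m x y z w 4) b * indR (t7m x y z w 5) c +
        indR (tPD x y z w) a * indR (t7p x y z w 4) b * indR (t10m x y z w) c + indR (tPD x y z w) a * indR (t7m x y z w 4) b * indR (t10p x y z w) c +
        indR (tPD x y z w) a * indR (tQ x y z w) b * indR (t11 x y z w) c) := by
    funext a b c
    exact K3_apply x y z w a b c
  rw [hK, typedCount_sub]
  simp only [typedCount_add, typedCount_tables F w₀ τ k hk]
  simp only [Five.cntPos14, Five.cntNeg14, Deg3.posMonos, Deg3.negMonos, List.map_cons, List.map_nil, List.sum_cons,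
    List.sum_nil, add_zero, tab0, tab1, tab2, tab3, tab4, tab5, tab6, tab7, tab8, tab9, tab10, tab11, tab12,
    tab13, tab14, tab15, tab16, tab17, tab18]
  push_cast
  ring

end Counts

/-! ## The digit bridge through the five-digit slices -/

section Digits

/-- **Every typed coefficient of `K₃` on `K₅ + {a₃x, a₃y, a₃z, a₃w}` is `≥ 0`** given the `1024` five-digit slice
certificates of the quadruple: `cntNeg14 x y z w k ≤ cntPos14 x y z w k`. -/
theorem cntNeg14_le_cntPos14 (x y z w : Fin 5) {L : Fin 19 → Bool → Bool → Bool → Bool → Bool → ℕ}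
    (hL : Five.LitOK x y z w L) (hc : Five.Cert L) (k : Fin 14 → Fin 4) :
    Five.cntNeg14 x y z w k ≤ Five.cntPos14 x y z w k := by
  rw [Five.cntPos14_eq, Five.cntNeg14_eq]
  exact Five.cntNegS_le_cntPosS x y z w hL (hc (k 9) (k 10) (k 11) (k 12) (k 13)) (Five.restr k)

end Digits

/-! ## The typed base and (HCOV) on the family -/

section Base

variable {R : Type*} [Field R] [LinearOrder R] [IsStrictOrderedRing R]

/-- **Every weight-free typed count of `K₃` on `K₅ + {a₃x, a₃y, a₃z, a₃w}` is nonnegative** — all minors `(F, w₀)`,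
all type maps. -/
theorem typedCount_K3_nonneg (x y z w : Fin 5) {L : Fin 19 → Bool → Bool → Bool → Bool → Bool → ℕ}
    (hL : Five.LitOK x y z w L) (hc : Five.Cert L) (F : Finset (Fin 14)) (w₀ : Config (Fin 14)) (τ : Fin 14 → ℕ) :
    0 ≤ typedCount F w₀ τ (CovForm.K3 (R := R) (ends14 x y z w) 0 1 2 5 4) := by
  by_cases hτ : ∀ e ∈ F, τ e ≤ 3
  · obtain ⟨k, hk⟩ := exists_profile F w₀ τ hτ
    rw [typedCount_K3_eq x y z w F w₀ τ k hk, sub_nonneg]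
    exact_mod_cast cntNeg14_le_cntPos14 x y z w hL hc k
  · have : typedCount F w₀ τ (CovForm.K3 (R := R) (ends14 x y z w) 0 1 2 5 4) = 0 := by
      unfold typedCount
      refine Finset.sum_eq_zero fun x _ => Finset.sum_eq_zero fun y _ =>
        Finset.sum_eq_zero fun w _ => ?_
      rw [if_neg]
      rintro ⟨-, h2⟩
      apply hτ
      intro e he
      rw [← h2 e he]
      unfold openCount
      have := Bool.toNat_le (x e)
      have := Bool.toNat_le (y e)
      have := Bool.toNat_le (w e)
      omega
    rw [this]

/-- **THEOREM 29 (typed form): row 2′TRI on `K₅ + {a₃x, a₃y, a₃z, a₃w}`** given the quadruple's slice certificates —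
`CovForm.TypedBases (ends14 x y z w) 0 1 2 5 4`. -/
theorem typedBases (x y z w : Fin 5) {L : Fin 19 → Bool → Bool → Bool → Bool → Bool → ℕ}
    (hL : Five.LitOK x y z w L) (hc : Five.Cert L) : CovForm.TypedBases (R := R) (ends14 x y z w) 0 1 2 5 4 :=
  fun F w₀ τ _ => typedCount_K3_nonneg x y z w hL hc F w₀ τ

/-- **THEOREM 29: (HCOV) on every `K₅ + {a₃x, a₃y, a₃z, a₃w}` instance** given the quadruple's slice certificates —
`CovForm.HCov p (ends14 x y z w) 0 1 2 5 4` for every probability vector `p : Fin 14 → R` (every weight vector,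
missing edges at weight `0`). -/
theorem HCov_deg4 (x y z w : Fin 5) {L : Fin 19 → Bool → Bool → Bool → Bool → Bool → ℕ}
    (hL : Five.LitOK x y z w L) (hc : Five.Cert L) (p : Fin 14 → R) (hp : IsProbVec p) :
    CovForm.HCov p (ends14 x y z w) 0 1 2 5 4 :=
  CovForm.HCov_of_typedBases (ends14 x y z w) 0 1 2 5 4 (typedBases x y z w hL hc) p hp

end Base

end Deg4

end Summit.Ventures.PercRepro2
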